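import Summits.HubbardSuperconductivity.HubbardLadder.Oct12It4Invariance
import Summits.HubbardSuperconductivity.HubbardLadder.PairOpTable
import Summits.HubbardSuperconductivity.HubbardLadder.ClusterCutRowTorus
import Summits.HubbardSuperconductivity.HubbardLadder.GroupAlgebraPieces
import Summits.HubbardSuperconductivity.HubbardLadder.PieceDecomposition

/-!
# Oct12It4RowOfH0 — the it4_s4b row from the weight-zero Rayleigh bound alone ([C](d2), outer assembly)

HONEST FRAMING: ladder R1–R4 with certified numbers; no claim on H/H₀.  Cell pub-hubbard, lane r2 (g43).  This file discharges
EVERYTHING of the [C](d) assembly that does not depend on the per-cut kernel certificates: given only the weight-zero Rayleigh bound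
`h0 : ∀ v, S^z_tot v = 0 → (2·DEN·σ)·‖v‖² ≤ Re⟨v, xIt4 v⟩` (which [C](b)+(c) produce from the twelve kernel frame certificates via
`rayleigh_ge_of_pieces` and `oct12_pieces (oct12SymRep 2) … xIt4_commute_oct12SymRep`), it proves the MANIFEST HEAD row
`oct12_it4_s4b_row` verbatim: [D] (`posSemidef_sub_smul_of_weightZero_spinHalf`, with `SU(2)`-invariance and Hermiticity of `X_w` proved
here generically) → the scaling identity `weightedPairOp_realDiv` → the torus window [A]+[R] (`clusterCutRow_window`) → per-cut bookkeeping by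
`simp` + `norm_num`.  `DEN = 10⁶`, `σ = −931/5000`.  §3 goes one step further in: with the twelve symmetry PIECES
`oct12Piece b = algOp (oct12SymRep 2) (tableOfInt 16 (oct12Table b))` (Hermitian, orthogonal, complete, commuting with `xIt4` — all from
`oct12_pieces` with `hU := conjTranspose_oct12SymRep 2`, `hX := xIt4_commute_oct12SymRep`), the row follows from the twelve PER-PIECE bounds
`hblk b` alone (`oct12_it4_s4b_row_of_hblk`, via `rayleigh_ge_of_pieces`) — `hblk b` is exactly what a kernel frame certificate for piece `b`
delivers through `piece_bound_of_frame` + `rayleigh_ge_of_frame`.  All [folklore].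
-/

namespace Summit.HubbardSuperconductivity.HubbardLadder.ClusterCut

open Matrix Literature.MathematicalPhysics.QuantumLattice
open scoped ComplexOrder

variable {N : ℕ}

/-! ## §1 Generic: `X_w` is `SU(2)`-invariant, and Hermitian for a real table -/

/-- `X_w` commutes with every component of the total spin. [folklore] -/
theorem weightedPairOp_commute_totalSpin (n : ℕ) (w : Fin N → Fin N → ℂ) (α : Fin 3) :
    weightedPairOp n w * totalSpin n α = totalSpin n α * weightedPairOp n w := by
  unfold weightedPairOp
  simp only [Finset.sum_mul, Finset.mul_sum, Matrix.smul_mul, Matrix.mul_smul, (commute_spinDot_totalSpin n _ _ α).eq]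

/-- `X_w` is Hermitian for a real weight table. [folklore] -/
theorem isHermitian_weightedPairOp_real (n : ℕ) (w : Fin N → Fin N → ℝ) :
    (weightedPairOp n (fun i j => ((w i j : ℝ) : ℂ))).IsHermitian := by
  unfold weightedPairOp Matrix.IsHermitian
  simp only [Matrix.conjTranspose_sum, Matrix.conjTranspose_smul, (spinDot_isHermitian (n := n) _ _).eq, Complex.star_def,
    Complex.conj_ofReal]

/-- **[D] for a real weight table**: a weight-zero Rayleigh bound for `X_w` gives the operator inequality `X_w ≥ s` (spin ½, even `N`). [folklore] -/
theorem posSemidef_weightedPairOp_sub_of_h0 (hN : Even N) (w : Fin N → Fin N → ℝ) {s : ℝ}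
    (h0 : ∀ v : TensorIndex (Fin N) 2 → ℂ, (totalSpin 1 2 : Op (Fin N) 2) *ᵥ v = 0 →
      s * (star v ⬝ᵥ v).re ≤ (star v ⬝ᵥ weightedPairOp 1 (fun i j => ((w i j : ℝ) : ℂ)) *ᵥ v).re) :
    (weightedPairOp 1 (fun i j => ((w i j : ℝ) : ℂ)) - (s : ℂ) • (1 : Op (Fin N) 2)).PosSemidef :=
  posSemidef_sub_smul_of_weightZero_spinHalf (by rwa [Fintype.card_fin]) (isHermitian_weightedPairOp_real 1 w)
    (weightedPairOp_commute_totalSpin 1 _) h0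

/-! ## §2 The it4_s4b row from `h0` -/

/-- The twelve oct12 sites (4×4 minus corners), in the order of `Oct12Representation` / eng-1's cut data. -/
def siteOct12 : Fin 12 → ℕ × ℕ :=
  ![(0, 1), (0, 2), (1, 0), (1, 1), (1, 2), (1, 3), (2, 0), (2, 1), (2, 2), (2, 3), (3, 1), (3, 2)]

/-- The real weight table of it4_s4b: `wSymIt4 / (2·DEN)`. -/
noncomputable def wRealIt4 : Fin 12 → Fin 12 → ℝ := fun i j => ((wSymIt4 i j : ℤ) : ℝ) / 2000000

/-- Rescaling the Rayleigh bound from `xIt4` (integer table) to `X_{wRealIt4}`. [folklore] -/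
theorem h0_rescale {s : ℝ}
    (h0 : ∀ v : TensorIndex (Fin 12) 2 → ℂ, (totalSpin 1 2 : Op (Fin 12) 2) *ᵥ v = 0 →
      (2000000 * s) * (star v ⬝ᵥ v).re ≤ (star v ⬝ᵥ xIt4 *ᵥ v).re) :
    ∀ v : TensorIndex (Fin 12) 2 → ℂ, (totalSpin 1 2 : Op (Fin 12) 2) *ᵥ v = 0 →
      s * (star v ⬝ᵥ v).re ≤ (star v ⬝ᵥ weightedPairOp 1 (fun i j => ((wRealIt4 i j : ℝ) : ℂ)) *ᵥ v).re := by
  intro v hv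
  have h := h0 v hv
  have hX : weightedPairOp 1 (fun i j => ((wRealIt4 i j : ℝ) : ℂ)) = (((1 : ℝ) / 2000000 : ℝ) : ℂ) • xIt4 := by
    unfold wRealIt4 xIt4
    exact weightedPairOp_realDiv 1 wSymIt4 2000000
  rw [hX, Matrix.smul_mulVec, dotProduct_smul, smul_eq_mul, Complex.mul_re, Complex.ofReal_re, Complex.ofReal_im, zero_mul,
    sub_zero]
  linarith

/-- **The it4_s4b row from the weight-zero Rayleigh bound** (`DEN = 10⁶`, `σ = −931/5000`, so `2·DEN·σ = −372400`): the MANIFEST HEAD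
`oct12_it4_s4b_row` follows from `h0` for `xIt4` by [D] + the torus window + bookkeeping.  [C](d) closes `h0` from the kernel side. [folklore] -/
theorem oct12_it4_s4b_row_of_h0
    (h0 : ∀ v : TensorIndex (Fin 12) 2 → ℂ, (totalSpin 1 2 : Op (Fin 12) 2) *ᵥ v = 0 →
      (2000000 * ((-931 : ℝ) / 5000)) * (star v ⬝ᵥ v).re ≤ (star v ⬝ᵥ xIt4 *ᵥ v).re)
    (L : ℕ) (hL : 4 ≤ L) :
    ((-931 : ℝ) / 5000) ≤ 3 * (((35293 : ℝ) / 62500) * heisRedCorr2 L 1 0 1 + ((-5259 : ℝ) / 125000) * heisRedCorr2 L 1 0 2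
      + ((-6057 : ℝ) / 250000) * heisRedCorr2 L 1 0 3 + ((-33673 : ℝ) / 500000) * heisRedCorr2 L 1 1 1
      + ((-221 : ℝ) / 1250) * heisRedCorr2 L 1 1 2 + ((-513 : ℝ) / 125000) * heisRedCorr2 L 1 1 3
      + ((-142 : ℝ) / 15625) * heisRedCorr2 L 1 2 2) := by
  haveI : NeZero L := ⟨by omega⟩
  have hsite : ∀ i, (siteOct12 i).1 < L ∧ (siteOct12 i).2 < L := by
    intro i; fin_cases i <;> simp [siteOct12] <;> omega
  have hinj : Function.Injective siteOct12 := by decide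
  have hw : ∀ i, wRealIt4 i i = 0 := by
    intro i; simp [wRealIt4, wSymIt4_diag]
  have hpsd : ((∑ i, ∑ j, ((wRealIt4 i j : ℝ) : ℂ) • spinDot 1 i j : Op (Fin 12) 2)
      - ((((-931 : ℝ) / 5000) : ℝ) : ℂ) • (1 : Op (Fin 12) 2)).PosSemidef :=
    posSemidef_weightedPairOp_sub_of_h0 (by decide) wRealIt4 (h0_rescale h0)
  have h := clusterCutRow_window L siteOct12 hsite hinj wRealIt4 hw _ hpsd
  simp only [Fin.sum_univ_succ, Fin.sum_univ_zero, siteOct12, wRealIt4, wSymIt4, Matrix.cons_val_succ, Matrix.cons_val_zero] at h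
  norm_num [heisRedCorr2_swap L 1 1 0, heisRedCorr2_swap L 1 2 0, heisRedCorr2_swap L 1 3 0, heisRedCorr2_swap L 1 2 1,
    heisRedCorr2_swap L 1 3 1, heisRedCorr2_swap L 1 3 2] at h
  linarith

/-! ## §3 The it4_s4b row from the twelve per-piece bounds -/

/-- The symmetry piece (isotypic projector) number `b` of the oct12 cluster, spin ½: `P_b = (1/16) Σ_g oct12Table b g • U_g`. -/
noncomputable def oct12Piece (b : Fin 12) : Op (Fin 12) 2 :=
  algOp (oct12SymRep 2) (tableOfInt 16 (oct12Table b))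

/-- **The it4_s4b row from per-piece bounds**: if on every piece the weight-zero Rayleigh bound `−372400·‖P_b v‖² ≤ Re⟨P_b v, xIt4 P_b v⟩`
holds (`v` with `S^z_tot v = 0`), the MANIFEST HEAD row follows — pieces from `oct12_pieces`, gluing by `rayleigh_ge_of_pieces`, then §2. [folklore] -/
theorem oct12_it4_s4b_row_of_hblk
    (hblk : ∀ (b : Fin 12) (v : TensorIndex (Fin 12) 2 → ℂ), (totalSpin 1 2 : Op (Fin 12) 2) *ᵥ v = 0 →
      (2000000 * ((-931 : ℝ) / 5000)) * (star (oct12Piece b *ᵥ v) ⬝ᵥ (oct12Piece b *ᵥ v)).re ≤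
        (star (oct12Piece b *ᵥ v) ⬝ᵥ xIt4 *ᵥ (oct12Piece b *ᵥ v)).re)
    (L : ℕ) (hL : 4 ≤ L) :
    ((-931 : ℝ) / 5000) ≤ 3 * (((35293 : ℝ) / 62500) * heisRedCorr2 L 1 0 1 + ((-5259 : ℝ) / 125000) * heisRedCorr2 L 1 0 2
      + ((-6057 : ℝ) / 250000) * heisRedCorr2 L 1 0 3 + ((-33673 : ℝ) / 500000) * heisRedCorr2 L 1 1 1
      + ((-221 : ℝ) / 1250) * heisRedCorr2 L 1 1 2 + ((-513 : ℝ) / 125000) * heisRedCorr2 L 1 1 3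
      + ((-142 : ℝ) / 15625) * heisRedCorr2 L 1 2 2) := by
  obtain ⟨hherm, horth, hcomm, hsum⟩ := oct12_pieces (oct12SymRep 2) (conjTranspose_oct12SymRep 2) xIt4_commute_oct12SymRep
  refine oct12_it4_s4b_row_of_h0 (fun v hv => ?_) L hL
  exact rayleigh_ge_of_pieces (Z := (totalSpin 1 2 : Op (Fin 12) 2)) oct12Piece hherm horth hcomm (fun w _ => hsum w) hblk v hv

end Summit.HubbardSuperconductivity.HubbardLadder.ClusterCut
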